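import Summits.Ventures.DiscreteObjects.Hadamard.ItoTypeAut334
import Summits.Ventures.DiscreteObjects.Hadamard.Order167InvertingIsInvolution668
import Summits.Ventures.DiscreteObjects.Hadamard.WilliamsonSequences167Iff668
import Summits.Ventures.DiscreteObjects.Hadamard.SignedAutDictionary

/-!
# H(668): an element of order 334 inverted by an automorphism WITH A FIXED ROW forces Williamson sequences of length 167
# (kernel) — part A: the sign analysis (reflection identities, `ε = −1`, CRT parity); part B = `Order334InvertingFixedWilliamson668`

Framing: lottery ticket; floor = certified bounds/negative ranges.

Cell pub-namedobj (venture DiscreteObjects), target (H), hadamard gen 23; HANDOFF-H-g22 item 2(a).  Let `g = (π, κ, d, e)` be a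
signed automorphism of PAIR ORDER `334` of a hypothetical Hadamard matrix `H` of order `668` (equivalently `σ = g²` of order
`167` with the centralising involution `τ = g¹⁶⁷`: centraliser index `≥ 2`, the Ito / negacyclic line, `Order334ItoTfae668`),
and let `ρ' = (π', κ', d', e')` be a signed automorphism INVERTING `g` (`π'π = π^ν π'`, `κ'κ = κ^ν κ'`, `ν ≡ −1 (mod 334)`)
which FIXES A ROW `x₀`.  Gen 19 reads off `H` the negaperiodic pair `u_y(t) = cyc_κ(y, t) · H(x₀, κ^t y)` (`t ∈ ℤ/668`,
antiperiodic); gen 23 (`NegaPairItoQuadruple`) splits it along `ℤ/668 ≃ ℤ/4 × ℤ/167` into a quasi-Williamson quadruple.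
Here we show that `ρ'` makes the pair REVERSAL-SYMMETRIC and the quadruple SYMMETRIC:
* `inverting334_chi_const`: the signed automorphism `(ρ'g)²` has trivial pair, so the sign
  `χ(j) = e(j) e'(κ j) e'(j) e(κ'κ j)` is a constant `ε = ±1` (the sign in `R' K R'⁻¹ = ε K⁻¹` for the signed permutation
  matrices); `inverting334_cyc_reflect`: by induction, `cyc(z, t) e'(κ^t z) = ε^t e'(z) cyc(κ' z, 668q − t)`.
* `inverting334_col_orbit` (gen 22's all-or-none at `σ = g²`, using the fixed row): `ρ'` preserves every column `σ`-orbit,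
  `κ' y = κ^{2c} y`; hence (`inverting334_U_reflect`) `u_y(2c − t) = K ε^t u_y(t)`, and for the translate `v_y(t) = u_y(t + c)`:
  `v_y(−t) = ε^t v_y(t)`; antiperiodicity at `t = 167` forces **`ε = −1`** (`inverting334_eps`), so `v_y(−t) = (−1)^t v_y(t)`.
* along the CRT (`ℤ/668 → ℤ/4`: `t ↦ t mod 4` has the parity of `t`): `a = v(0, ·)` and `b = v(1, ·)` are SYMMETRIC
  (`b(−j) = −v(3, −j)·… = b(j)` uses the antiperiod `(2, 0)`); the four sequences from `v_{y₁}, v_{y₂}` keep `Σ PAF = 0`.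
The theorem itself (∃ Williamson sequences of length 167; existence-level corollaries with gen 22's
`WilliamsonSequences167Iff668`) is part B, `Order334InvertingFixedWilliamson668`.  This part A also re-proves the small
periodicity facts for the signed cycle entries (`U_add_668`, `U_add_334`, `translate_seq_eq`) and packages the CRT parity
(`crt668`: `ℤ/668 ≃+* ℤ/4 × ℤ/167` sends `334 ↦ (2, 0)`, first component `0` ⇒ `(−1)^{t.val} = 1`, `3` ⇒ `−1`).
STRUCTURE / DICTIONARY of a hypothetical object; no order excluded; H(668) untouched.  Ours; no `sorry`, no definitions,
default heartbeats.
-/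

namespace Summit.Ventures.DiscreteObjects.Hadamard

open Finset BigOperators Matrix

open Literature.Combinatorics.Designs.GoethalsSeidel (IsHadamardMatrix)
open Literature.Combinatorics.Designs.LegendrePairs (PAF IsPM translate PAF_translate)

variable {ι : Type*} [Fintype ι] [DecidableEq ι]

section main
variable {H : Matrix ι ι ℤ} (hH : IsHadamardMatrix H) (hι : Fintype.card ι = 668)
  {π κ π' κ' : Equiv.Perm ι} {d e d' e' : ι → ℤ} (haut : IsSignedAut H π κ d e)
  (hπ : π ^ 334 = 1) (hκ : κ ^ 334 = 1) (h2 : π ^ 2 ≠ 1 ∨ κ ^ 2 ≠ 1) (h167 : π ^ 167 ≠ 1 ∨ κ ^ 167 ≠ 1)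
  (haut' : IsSignedAut H π' κ' d' e') {ν : ℕ} (hnπ : π' * π = π ^ ν * π') (hnκ : κ' * κ = κ ^ ν * κ') (hν : ν % 334 = 333)
include hH hι haut hπ hκ h2 haut' hnπ hnκ hν

/-! ### the gen-22 inputs at `σ = g²` -/

omit [Fintype ι] [DecidableEq ι] hH hι haut hπ hκ h2 haut' hnκ hν in
/-- `ρ'` inverts `σ = g²` with multiplier `ν`: `π' π² = (π²)^ν π'` -/
lemma inverting334_sq_rel : π' * π ^ 2 = (π ^ 2) ^ ν * π' := by
  rw [norm_comm_pow hnπ 2, mul_comm ν 2, pow_mul]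

omit [Fintype ι] [DecidableEq ι] hH hι haut hπ hκ h2 haut' hnπ hν in
/-- column form of `inverting334_sq_rel` -/
lemma inverting334_sq_rel' : κ' * κ ^ 2 = (κ ^ 2) ^ ν * κ' := by
  rw [norm_comm_pow hnκ 2, mul_comm ν 2, pow_mul]

/-- `ρ' g` is also an inverting element, hence a pair-involution: `(π'π)² = (κ'κ)² = 1` -/
lemma inverting334_mul_sq_eq_one : (π' * π) ^ 2 = 1 ∧ (κ' * κ) ^ 2 = 1 := by
  have hμ : ν % 167 = 166 := by omega
  have hσπ : (π ^ 2) ^ 167 = 1 := by rw [← pow_mul]; exact hπ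
  have hσκ : (κ ^ 2) ^ 167 = 1 := by rw [← pow_mul]; exact hκ
  have hrπ : π' * π * π ^ 2 = (π ^ 2) ^ ν * (π' * π) := by
    rw [mul_assoc, ← pow_succ', norm_comm_pow hnπ (2 + 1), ← pow_mul, hnπ, ← mul_assoc, ← pow_add,
      show ν * (2 + 1) = 2 * ν + ν by ring]
  have hrκ : κ' * κ * κ ^ 2 = (κ ^ 2) ^ ν * (κ' * κ) := by
    rw [mul_assoc, ← pow_succ', norm_comm_pow hnκ (2 + 1), ← pow_mul, hnκ, ← mul_assoc, ← pow_add,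
      show ν * (2 + 1) = 2 * ν + ν by ring]
  exact hadamard668_order167_inverting_sq_eq_one hH hι (isSignedAut_pow haut 2) hσπ hσκ h2 (isSignedAut_mul haut' haut)
    hrπ hrκ hμ

/-- with a fixed row, `ρ'` preserves every column orbit of `σ = g²`: `κ' y = κ^{2c} y` -/
lemma inverting334_col_orbit {x₀ : ι} (hfix : π' x₀ = x₀) (y : ι) : ∃ c : ℕ, c < 167 ∧ (κ ^ (2 * c)) y = κ' y := by
  have hμ : ν % 167 = 166 := by omega
  have hσπ : (π ^ 2) ^ 167 = 1 := by rw [← pow_mul]; exact hπ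
  have hσκ : (κ ^ 2) ^ 167 = 1 := by rw [← pow_mul]; exact hκ
  rcases hadamard668_order167_inverting_all_or_none hH hι (isSignedAut_pow haut 2) hσπ hσκ h2 haut'
      (inverting334_sq_rel hnπ) (inverting334_sq_rel' hnκ) hμ with ⟨-, hcol, -, -⟩ | ⟨-, -, hcard0, -⟩
  · obtain ⟨c, hc, hcy⟩ := Finset.mem_image.mp (hcol y)
    exact ⟨c, Finset.mem_range.mp hc, by rw [pow_mul]; exact hcy⟩
  · exfalso
    have hx : x₀ ∈ (univ.filter fun x => π' x = x) := Finset.mem_filter.mpr ⟨Finset.mem_univ _, hfix⟩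
    rw [Finset.card_eq_zero.mp hcard0] at hx
    simp at hx

/-- with a fixed row, `ρ'² = +1` as a signed map: `e'(κ' j) e'(j) = 1` -/
lemma inverting334_sq_sign {x₀ : ι} (hfix : π' x₀ = x₀) (j : ι) : e' (κ' j) * e' j = 1 := by
  have hcard : (Fintype.card ι : ℤ) ≠ 0 := by rw [hι]; norm_num
  have hμ : ν % 167 = 166 := by omega
  have hσπ : (π ^ 2) ^ 167 = 1 := by rw [← pow_mul]; exact hπ
  have hσκ : (κ ^ 2) ^ 167 = 1 := by rw [← pow_mul]; exact hκ
  -- `ρ'` is a pair-involution (gen 22's unconditional involution theorem at `σ = g²`)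
  obtain ⟨hp2, hk2⟩ := hadamard668_order167_inverting_sq_eq_one hH hι (isSignedAut_pow haut 2) hσπ hσκ h2 haut'
    (inverting334_sq_rel hnπ) (inverting334_sq_rel' hnκ) hμ
  have h1 := isSignedAut_mul haut' haut'
  rw [show π' * π' = 1 from by rw [← pow_two]; exact hp2] at h1
  obtain ⟨-, c, -, hD, hE⟩ := signedAut_pm_one_of_fst_eq_one hH hcard h1 (p := 1) odd_one
    (by rw [pow_one, ← pow_two]; exact hk2)
  have hc1 : c = 1 := by rw [← hD x₀, hfix]; exact pm_mul_self (haut'.1 x₀)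
  rw [hE j, hc1]

/-- **the constant sign `ε`.**  `χ(j) = e(j) e'(κ j) e'(j) e(κ'(κ j))` is a constant `±1` (the column sign of the signed
automorphism `(ρ' g)²`, whose pair is trivial). -/
lemma inverting334_chi_const {x₀ : ι} (hfix : π' x₀ = x₀) :
    ∃ ε : ℤ, (ε = 1 ∨ ε = -1) ∧ ∀ j, e j * e' (κ j) * e' j * e (κ' (κ j)) = ε := by
  have hcard : (Fintype.card ι : ℤ) ≠ 0 := by rw [hι]; norm_num
  obtain ⟨hP, hK⟩ := inverting334_mul_sq_eq_one hH hι haut hπ hκ h2 haut' hnπ hnκ hν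
  have h1 := isSignedAut_mul haut' haut
  have h2c := isSignedAut_mul h1 h1
  rw [show π' * π * (π' * π) = 1 from by rw [← pow_two]; exact hP] at h2c
  obtain ⟨-, ε, hε, -, hE⟩ := signedAut_pm_one_of_fst_eq_one hH hcard h2c (p := 1) odd_one
    (by rw [pow_one, ← pow_two]; exact hK)
  refine ⟨ε, hε, fun j => ?_⟩
  -- `κ (κ' (κ j)) = κ' j`
  have hν' : κ ^ ν = κ ^ 333 := by rw [← pow_mod_of_pow_eq_one κ hκ ν, hν]
  have hkk : κ (κ' (κ j)) = κ' j := by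
    have h0 : κ' (κ j) = (κ ^ 333) (κ' j) := by rw [← hν', ← Equiv.Perm.mul_apply, hnκ, Equiv.Perm.mul_apply]
    rw [h0, ← Equiv.Perm.mul_apply, ← pow_succ', hκ, Equiv.Perm.one_apply]
  have hEj := hE j
  simp only [Equiv.Perm.mul_apply] at hEj
  have hfixsign : e' (κ' j) = e' j := by
    have h0 := inverting334_sq_sign hH hι haut hπ hκ h2 haut' hnπ hnκ hν hfix j
    calc e' (κ' j) = e' (κ' j) * (e' j * e' j) := by rw [pm_mul_self (haut'.2.1 j), mul_one]
      _ = (e' (κ' j) * e' j) * e' j := by ring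
      _ = e' j := by rw [h0, one_mul]
  rw [hkk, hfixsign] at hEj
  rw [← hEj]; ring

omit [Fintype ι] [DecidableEq ι] hH hι haut hπ h2 haut' hnπ in
/-- **the reflection identity for signed cycle products.**  If `χ ≡ ε` then for `t ≤ 668q` and every `z`:
`cyc(z, t) · e'(κ^t z) = ε^t · e'(z) · cyc(κ' z, 668q − t)` (the function form of `R' K^t = ε^t K^{−t} R'`). -/
lemma inverting334_cyc_reflect (hnegC : ∀ j, cyc κ e j 334 = -1) (he' : ∀ j, e' j = 1 ∨ e' j = -1) {ε : ℤ}
    (hχ : ∀ j, e j * e' (κ j) * e' j * e (κ' (κ j)) = ε) (q : ℕ) :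
    ∀ t, t ≤ 668 * q → ∀ z, cyc κ e z t * e' ((κ ^ t) z) = ε ^ t * e' z * cyc κ e (κ' z) (668 * q - t) := by
  intro t
  induction t with
  | zero =>
    intro _ z
    rw [show 668 * q - 0 = 0 + 668 * q by omega, cyc_add_668_mul_of_nega κ e hnegC]
    simp [cyc]
  | succ t ih =>
    intro ht z
    have IH := ih (by omega) z
    obtain ⟨N, hN⟩ : ∃ N, 668 * q - t = N + 1 := ⟨668 * q - (t + 1), by omega⟩
    have hN' : 668 * q - (t + 1) = N := by omega
    rw [hN, cyc_succ' κ e (κ' z) N] at IH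
    rw [hN']
    have hexp : N % 334 = (ν * (t + 1)) % 334 := by rw [Nat.mul_mod, hν]; omega
    have hpos : (κ ^ N) (κ' z) = κ' ((κ ^ (t + 1)) z) := by
      rw [norm_apply_pow hnκ (t + 1) z, ← pow_mod_of_pow_eq_one κ hκ N, hexp, pow_mod_of_pow_eq_one κ hκ]
    have hk1 : κ ((κ ^ t) z) = (κ ^ (t + 1)) z := by rw [pow_succ', Equiv.Perm.mul_apply]
    have hχ' : e ((κ ^ t) z) * e' ((κ ^ (t + 1)) z) * e' ((κ ^ t) z) * e ((κ ^ N) (κ' z)) = ε := by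
      rw [hpos, ← hk1]; exact hχ _
    have hsq1 : e' ((κ ^ t) z) * e' ((κ ^ t) z) = 1 := pm_mul_self (he' _)
    have hc : cyc κ e z t = ε ^ t * e' z * (cyc κ e (κ' z) N * e ((κ ^ N) (κ' z))) * e' ((κ ^ t) z) := by
      calc cyc κ e z t = cyc κ e z t * (e' ((κ ^ t) z) * e' ((κ ^ t) z)) := by rw [hsq1, mul_one]
        _ = (cyc κ e z t * e' ((κ ^ t) z)) * e' ((κ ^ t) z) := by ring
        _ = _ := by rw [IH]
    rw [cyc_succ' κ e z t, pow_succ ε t, hc]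
    calc ε ^ t * e' z * (cyc κ e (κ' z) N * e ((κ ^ N) (κ' z))) * e' ((κ ^ t) z) * e ((κ ^ t) z) *
          e' ((κ ^ (t + 1)) z)
        = ε ^ t * e' z * cyc κ e (κ' z) N *
            (e ((κ ^ t) z) * e' ((κ ^ (t + 1)) z) * e' ((κ ^ t) z) * e ((κ ^ N) (κ' z))) := by ring
      _ = ε ^ t * e' z * cyc κ e (κ' z) N * ε := by rw [hχ']
      _ = ε ^ t * ε * e' z * cyc κ e (κ' z) N := by ring

omit [Fintype ι] [DecidableEq ι] hH hι haut hπ h2 hnπ in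
/-- **the reflected signed entry.**  For a fixed row `x₀` and a column `y` with `κ' y = κ^{2c} y`, if `χ ≡ ε`:
`u_y(2c + (668q − t)) = (cyc(y,2c) e'(y) d'(x₀)) · ε^t · u_y(t)`, `u_y(m) = cyc(y, m) H(x₀, κ^m y)`. -/
lemma inverting334_U_reflect (hnegC : ∀ j, cyc κ e j 334 = -1) {ε : ℤ} (hε : ε = 1 ∨ ε = -1)
    (hχ : ∀ j, e j * e' (κ j) * e' j * e (κ' (κ j)) = ε) {x₀ y : ι} (hfix : π' x₀ = x₀) {c : ℕ}
    (hc : (κ ^ (2 * c)) y = κ' y) (q t : ℕ) (ht : t ≤ 668 * q) :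
    cyc κ e y (2 * c + (668 * q - t)) * H x₀ ((κ ^ (2 * c + (668 * q - t))) y) =
      (cyc κ e y (2 * c) * e' y * d' x₀) * ε ^ t * (cyc κ e y t * H x₀ ((κ ^ t) y)) := by
  -- the entry identity from `ρ'`
  have hent : H x₀ ((κ ^ (2 * c + (668 * q - t))) y) = d' x₀ * e' ((κ ^ t) y) * H x₀ ((κ ^ t) y) := by
    have h0 := haut'.2.2 x₀ ((κ ^ t) y)
    rw [hfix, norm_apply_pow hnκ t y, ← hc, ← Equiv.Perm.mul_apply, ← pow_add] at h0
    have hmod : (ν * t + 2 * c) % 334 = (2 * c + (668 * q - t)) % 334 := by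
      rw [Nat.add_mod, Nat.mul_mod, hν]; omega
    rwa [← pow_mod_of_pow_eq_one κ hκ (ν * t + 2 * c), hmod, pow_mod_of_pow_eq_one κ hκ] at h0
  -- the cycle product splits at `2c`
  have hcy : cyc κ e y (2 * c + (668 * q - t)) = cyc κ e y (2 * c) * cyc κ e (κ' y) (668 * q - t) := by
    rw [cyc_add, hc]
  -- the reflection identity at `z = y`
  have hP := inverting334_cyc_reflect hκ hnκ hν hnegC haut'.2.1 hχ q t ht y
  have hεsq : ε ^ t * ε ^ t = 1 := by
    rw [← mul_pow]; rcases hε with rfl | rfl <;> simp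
  have he'y : e' y * e' y = 1 := pm_mul_self (haut'.2.1 y)
  have hE : e' ((κ ^ t) y) * e' ((κ ^ t) y) = 1 := pm_mul_self (haut'.2.1 _)
  have hC : cyc κ e (κ' y) (668 * q - t) = ε ^ t * e' y * cyc κ e y t * e' ((κ ^ t) y) := by
    calc cyc κ e (κ' y) (668 * q - t) = (ε ^ t * ε ^ t) * (e' y * e' y) * cyc κ e (κ' y) (668 * q - t) := by
          rw [hεsq, he'y, one_mul, one_mul]
      _ = ε ^ t * e' y * (ε ^ t * e' y * cyc κ e (κ' y) (668 * q - t)) := by ring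
      _ = ε ^ t * e' y * (cyc κ e y t * e' ((κ ^ t) y)) := by rw [← hP]
      _ = _ := by ring
  rw [hcy, hent, hC]
  calc cyc κ e y (2 * c) * (ε ^ t * e' y * cyc κ e y t * e' ((κ ^ t) y)) * (d' x₀ * e' ((κ ^ t) y) * H x₀ ((κ ^ t) y))
      = (cyc κ e y (2 * c) * e' y * d' x₀) * ε ^ t * (cyc κ e y t * H x₀ ((κ ^ t) y)) *
          (e' ((κ ^ t) y) * e' ((κ ^ t) y)) := by ring
    _ = _ := by rw [hE, mul_one]

omit [Fintype ι] [DecidableEq ι] hH hι haut hπ h2 haut' hnπ hnκ hν in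
/-- periodicity `668` of the signed cycle entries (nega-cycle of length `334`) -/
lemma U_add_668 (hnegC : ∀ j, cyc κ e j 334 = -1) (x₀ y : ι) (m q : ℕ) :
    cyc κ e y (m + 668 * q) * H x₀ ((κ ^ (m + 668 * q)) y) = cyc κ e y m * H x₀ ((κ ^ m) y) := by
  rw [cyc_add_668_mul_of_nega κ e hnegC, ← pow_mod_of_pow_eq_one κ hκ (m + 668 * q),
    show (m + 668 * q) % 334 = m % 334 by omega, pow_mod_of_pow_eq_one κ hκ]

omit [Fintype ι] [DecidableEq ι] hH hι haut hπ h2 haut' hnπ hnκ hν in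
/-- antiperiodicity `334` of the signed cycle entries -/
lemma U_add_334 (hnegC : ∀ j, cyc κ e j 334 = -1) (x₀ y : ι) (m : ℕ) :
    cyc κ e y (m + 334) * H x₀ ((κ ^ (m + 334)) y) = -(cyc κ e y m * H x₀ ((κ ^ m) y)) := by
  rw [cyc_add_334_of_nega κ e hnegC, pow_add, hκ, mul_one]; ring

omit [Fintype ι] [DecidableEq ι] hH hι hπ h2 hnπ in
/-- **the translated sequence is reversal-symmetric with sign `ε^s`:** with `v(s) = u_y(s + c)`,
`v(1336 − s) = ε^s v(s)` for `s ≤ 668` (`c < 167`). -/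
lemma inverting334_V_reflect (hnegC : ∀ j, cyc κ e j 334 = -1) (hH1 : ∀ i j, H i j = 1 ∨ H i j = -1) {ε : ℤ}
    (hε : ε = 1 ∨ ε = -1) (hχ : ∀ j, e j * e' (κ j) * e' j * e (κ' (κ j)) = ε) {x₀ y : ι} (hfix : π' x₀ = x₀) {c : ℕ}
    (hc167 : c < 167) (hc : (κ ^ (2 * c)) y = κ' y) (s : ℕ) (hs : s ≤ 668) :
    cyc κ e y (1336 - s + c) * H x₀ ((κ ^ (1336 - s + c)) y) = ε ^ s * (cyc κ e y (s + c) * H x₀ ((κ ^ (s + c)) y)) := by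
  have key : ∀ s', s' ≤ 668 → cyc κ e y (1336 - s' + c) * H x₀ ((κ ^ (1336 - s' + c)) y) =
      (cyc κ e y (2 * c) * e' y * d' x₀) * ε ^ c * ε ^ s' * (cyc κ e y (s' + c) * H x₀ ((κ ^ (s' + c)) y)) := by
    intro s' hs'
    have h := inverting334_U_reflect hκ haut' hnκ hν hnegC hε hχ hfix hc 2 (c + s') (by omega)
    rw [show 2 * c + (668 * 2 - (c + s')) = 1336 - s' + c by omega, show c + s' = s' + c by ring, pow_add ε s' c] at h
    rw [h]; ring
  -- at `s' = 0` the constant is `1`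
  have h0 := key 0 (by norm_num)
  rw [show 1336 - 0 + c = (0 + c) + 668 * 2 by ring, U_add_668 hκ hnegC, pow_zero, mul_one] at h0
  have hU0 : cyc κ e y (0 + c) * H x₀ ((κ ^ (0 + c)) y) ≠ 0 :=
    mul_ne_zero (pm_ne_zero (cyc_pm κ e haut.2.1 y _)) (pm_ne_zero (hH1 _ _))
  have hK : cyc κ e y (2 * c) * e' y * d' x₀ * ε ^ c = 1 := by
    have : (cyc κ e y (2 * c) * e' y * d' x₀ * ε ^ c - 1) * (cyc κ e y (0 + c) * H x₀ ((κ ^ (0 + c)) y)) = 0 := by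
      linarith
    rcases mul_eq_zero.mp this with h1 | h1
    · linarith
    · exact (hU0 h1).elim
  rw [key s hs, hK, one_mul]

omit [Fintype ι] [DecidableEq ι] hH hι hπ h2 hnπ in
/-- **`ε = −1`:** the reflection at `s = 167` meets the antiperiod `334`. -/
lemma inverting334_eps (hnegC : ∀ j, cyc κ e j 334 = -1) (hH1 : ∀ i j, H i j = 1 ∨ H i j = -1) {ε : ℤ}
    (hε : ε = 1 ∨ ε = -1) (hχ : ∀ j, e j * e' (κ j) * e' j * e (κ' (κ j)) = ε) {x₀ y : ι} (hfix : π' x₀ = x₀) {c : ℕ}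
    (hc167 : c < 167) (hc : (κ ^ (2 * c)) y = κ' y) : ε = -1 := by
  have h := inverting334_V_reflect haut hκ haut' hnκ hν hnegC hH1 hε hχ hfix hc167 hc 167 (by norm_num)
  rw [show 1336 - 167 + c = ((167 + c) + 334) + 668 * 1 by ring, U_add_668 hκ hnegC, U_add_334 hκ hnegC] at h
  have hU : cyc κ e y (167 + c) * H x₀ ((κ ^ (167 + c)) y) ≠ 0 :=
    mul_ne_zero (pm_ne_zero (cyc_pm κ e haut.2.1 y _)) (pm_ne_zero (hH1 _ _))
  have hε167 : ε ^ 167 = ε := by rcases hε with rfl | rfl <;> norm_num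
  rw [hε167] at h
  have : (ε + 1) * (cyc κ e y (167 + c) * H x₀ ((κ ^ (167 + c)) y)) = 0 := by linarith
  rcases mul_eq_zero.mp this with h1 | h1
  · linarith
  · exact (hU h1).elim

/-! ### the `ZMod 668` sequences -/

omit [Fintype ι] [DecidableEq ι] hH hι haut hπ h2 haut' hnπ hnκ hν in
/-- the translate by `c` of gen 19's sequence `t ↦ cyc(y, t.val) H(x₀, κ^{t.val} y)`, read in `ℕ` -/
lemma translate_seq_eq (hnegC : ∀ j, cyc κ e j 334 = -1) (x₀ y : ι) {c : ℕ} (hc668 : c < 668) (t : ZMod 668) :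
    translate (fun t : ZMod 668 => cyc κ e y t.val * H x₀ ((κ ^ t.val) y)) (c : ZMod 668) t =
      cyc κ e y (t.val + c) * H x₀ ((κ ^ (t.val + c)) y) := by
  have hκ668 : κ ^ 668 = 1 := by rw [show (668 : ℕ) = 334 * 2 by norm_num, pow_mul, hκ, one_pow]
  show cyc κ e y (t + (c : ZMod 668)).val * H x₀ ((κ ^ (t + (c : ZMod 668)).val) y) = _
  rw [ZMod.val_add, ZMod.val_natCast, Nat.mod_eq_of_lt hc668, cyc_mod_668_of_nega κ e hnegC,
    pow_mod_of_pow_eq_one κ hκ668]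

omit [Fintype ι] [DecidableEq ι] hH hι hπ h2 hnπ in
/-- **reversal symmetry on `ℤ/668`:** `v(−t) = (−1)^{t.val} v(t)` for the translated sequence. -/
lemma translate_seq_reflect (hnegC : ∀ j, cyc κ e j 334 = -1) (hH1 : ∀ i j, H i j = 1 ∨ H i j = -1)
    (hχ : ∀ j, e j * e' (κ j) * e' j * e (κ' (κ j)) = -1) {x₀ y : ι} (hfix : π' x₀ = x₀) {c : ℕ} (hc167 : c < 167)
    (hc : (κ ^ (2 * c)) y = κ' y) (t : ZMod 668) :
    translate (fun t : ZMod 668 => cyc κ e y t.val * H x₀ ((κ ^ t.val) y)) (c : ZMod 668) (-t) =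
      (-1) ^ t.val * translate (fun t : ZMod 668 => cyc κ e y t.val * H x₀ ((κ ^ t.val) y)) (c : ZMod 668) t := by
  rw [translate_seq_eq hκ hnegC x₀ y (by omega) t, translate_seq_eq hκ hnegC x₀ y (by omega) (-t), ZMod.neg_val]
  by_cases ht : t = 0
  · rw [if_pos ht, ht, ZMod.val_zero, pow_zero, one_mul]
  · rw [if_neg ht]
    have hlt := ZMod.val_lt t
    have h := inverting334_V_reflect haut hκ haut' hnκ hν hnegC hH1 (Or.inr rfl) hχ hfix hc167 hc t.val hlt.le
    rw [show 1336 - t.val + c = (668 - t.val + c) + 668 * 1 by omega, U_add_668 hκ hnegC] at h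
    exact h

/-! ### parity along the CRT -/

omit hH hι haut hπ hκ h2 haut' hnπ hnκ hν in
/-- the CRT ring isomorphism `ℤ/668 ≃ ℤ/4 × ℤ/167`: it sends `334` to `(2, 0)`, and the first component is the residue
`mod 4`, so it determines the parity of `t.val`. -/
lemma crt668 : ∃ f : ZMod 668 ≃+* ZMod 4 × ZMod 167, f 334 = (2, 0) ∧
    (∀ t : ZMod 668, (f t).1 = 0 → (-1 : ℤ) ^ t.val = 1) ∧ (∀ t : ZMod 668, (f t).1 = 3 → (-1 : ℤ) ^ t.val = -1) := by
  have hcop : Nat.Coprime 4 167 := by norm_num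
  let f : ZMod 668 ≃+* ZMod 4 × ZMod 167 := (ZMod.ringEquivCongr (by norm_num : 668 = 4 * 167)).trans
    (ZMod.chineseRemainder hcop)
  have hval : ∀ t : ZMod 668, (f t).1 = ((t.val : ℕ) : ZMod 4) := fun t => by
    conv_lhs => rw [← ZMod.natCast_zmod_val t, map_natCast]
    rfl
  refine ⟨f, ?_, fun t ht => ?_, fun t ht => ?_⟩
  · rw [show (334 : ZMod 668) = ((334 : ℕ) : ZMod 668) by norm_num, map_natCast]
    ext
    · rw [Prod.fst_natCast, show (334 : ℕ) = 83 * 4 + 2 by norm_num, Nat.cast_add, Nat.cast_mul]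
      rw [ZMod.natCast_self, mul_zero, zero_add]; rfl
    · rw [Prod.snd_natCast, show (334 : ℕ) = 2 * 167 by norm_num, Nat.cast_mul, ZMod.natCast_self, mul_zero]
  · rw [hval] at ht
    obtain ⟨m, hm⟩ := (ZMod.natCast_eq_zero_iff t.val 4).mp ht
    rw [hm, pow_mul]; norm_num
  · rw [hval, show (3 : ZMod 4) = ((3 : ℕ) : ZMod 4) by norm_num, ZMod.natCast_eq_natCast_iff'] at ht
    have hodd : Odd t.val := Nat.odd_iff.mpr (by omega)
    exact hodd.neg_one_pow

end main

end Summit.Ventures.DiscreteObjects.Hadamard
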